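import Summits.FinalStateConjecture.FinalStateConjecture.Theses.KerrnessPropagates
import Summits.FinalStateConjecture.FinalStateConjecture.Theorems.TameCensorship.Negative.TimeReversedRemnant

/-!
# `KerrBasinCapture` hands over configurations with NON-orthochronous motions (negative-side
read-back for crux `stmt-FinalStateConjecture-17646`, refuter crux-attack 2026-08-17)

The recurrence clause of `KerrnessPropagates.KerrBasinCapture` (and, verbatim, the recurrence
HYPOTHESIS of `KerrnessPropagates.KillingSpinorEndgame`) fixes a configuration
`p = (N; Mᵢ, aᵢ, r₀ᵢ; mo i : lorentzGroup × E4)` subject only to `Kerr.IsSubextremal (M i) (a i)` and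
`r₀ i ∈ Ioo r₋ r₊`; its one orientation condition concerns the FAR zone (`Φ_*∂₀` future-directed
where all `rⱼ ≥ Rⱼ − 1`). The prelude's `lorentzGroup` is the full group `O(1,3)`
(`TameCensorship.Negative.timeReversal_mem_lorentzGroup`), so the motions `Λᵢ = (mo i).1` handed
over need not be orthochronous in the sense of the Statement's
`Summit.FinalStateConjecture.IsOrthochronous` (clause (i) of `IsFutureOriented`). This file records,
as checked statements:

* `not_isOrthochronous_timeReversalLorentz` — time reversal `T` is not orthochronous;
* `exists_handover_motion_not_isOrthochronous` — a legal one-hole motion family of the clause's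
  type `Fin 1 → lorentzGroup × E4` violates `∀ i, IsOrthochronous (mo i).1`;
* `boostedKerrBilin_timeReversal_apply`, `restTime_timeReversal_on_labSlab` — for the motion
  `(T, c)` the near-zone reference form is the time-reversed Kerr–Schild form
  `g_{M,a}(T(x − c))(Tv, Tw)` (the outgoing, white-hole chart in lab coordinates) and the hole's
  rest-frame Kerr–Schild time on the lab slab `{x⁰ = τ}` is `c⁰ − τ`, decreasing in lab time.

Consequence (read-back for planners and provers, VETTING.md §5 (m1) of the crux attack): the
configuration `p` certified by CAPTURE may describe a white-hole near zone, so "CAPTURE hands over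
the exact FINAL charges" is not what the typed clause guarantees; the one-clause repair is to add
`Summit.FinalStateConjecture.IsOrthochronous (mo i).1` to the constraints on `p` in both decls
(CAPTURE becomes stronger, ENDGAME weaker, the assembly `closes` is unchanged in shape).
-/

noncomputable section

set_option linter.dupNamespace false

namespace Summit.FinalStateConjecture.FinalStateConjecture.Theorems.KerrBasinCapture.Negative

open Literature.Geometry.Lorentzian
open Summit.FinalStateConjecture.FinalStateConjecture.Theorems.TameCensorship.Negative

/-- **Time reversal is not orthochronous**: `(T e₀)⁰ = −1 < 0`, so `T ∈ O(1,3) ∖ O⁺(1,3)`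
(O'Neill 1983, Ch. 9, pp. 233–236). [cite: ONeill1983, Ch. 9  pp. 233–236] -/
theorem not_isOrthochronous_timeReversalLorentz :
    ¬ Summit.FinalStateConjecture.IsOrthochronous timeReversalLorentz := by
  unfold Summit.FinalStateConjecture.IsOrthochronous
  have h : ((timeReversalLorentz : lorentzGroup) : E4 ≃L[ℝ] E4) (E4.basisVector 0) 0 = -1 := by
    change timeReversal (E4.basisVector 0) 0 = -1
    rw [timeReversal_apply, timeReversalCLM_apply_zero]
    simp [E4.basisVector]
  rw [h]
  norm_num

/-- **The hand-over configurations of `KerrBasinCapture` / `KillingSpinorEndgame` include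
non-orthochronous motions**: a motion family of the clause's type `Fin 1 → lorentzGroup × E4`
(one hole, motion `(T, 0)`) for which `∀ i, IsOrthochronous (mo i).1` fails — the typed clause
constrains `p` by sub-extremality and `r₀ᵢ ∈ (r₋, r₊)` only. [folklore] -/
theorem exists_handover_motion_not_isOrthochronous :
    ∃ mo : Fin 1 → lorentzGroup × E4,
      ¬ ∀ i, Summit.FinalStateConjecture.IsOrthochronous (mo i).1 :=
  ⟨fun _ ↦ (timeReversalLorentz, 0), fun h ↦ not_isOrthochronous_timeReversalLorentz (h 0)⟩

/-- **The near-zone reference form of a time-reversed motion is the time-reversed Kerr–Schild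
form**: `boostedKerrBilin T c M a x v w = g_{M,a}(T(x − c))(T v, T w)` — in lab coordinates the
outgoing (white-hole) Kerr–Schild chart of Kerr `(M, a)` (Kerr–Schild 1965, Lorentz covariance of
the ansatz; the discrete element `T`). [cite: KerrSchild1965] -/
theorem boostedKerrBilin_timeReversal_apply (c : E4) (M a : ℝ) (x v w : E4) :
    boostedKerrBilin timeReversalLorentz c M a x v w =
      Kerr.bilin M a (timeReversalCLM (x - c)) (timeReversalCLM v) (timeReversalCLM w) := by
  rw [boostedKerrBilin_apply]
  rfl

/-- **On the lab slab `{x⁰ = τ}` the rest-frame Kerr–Schild time of the hole with motion `(T, c)`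
is `c⁰ − τ`**: it DEcreases as lab time increases, i.e. the near-zone background of such a hole is
read backwards in time relative to the future-oriented far zone (white-hole reading).
[folklore] -/
theorem restTime_timeReversal_on_labSlab (c x : E4) (τ : ℝ) (hx : x 0 = τ) :
    poincareInv timeReversalLorentz c x 0 = c 0 - τ := by
  rw [poincareInv_T_apply_zero, hx]

end Summit.FinalStateConjecture.FinalStateConjecture.Theorems.KerrBasinCapture.Negative

end
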